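import Mathlib
import Summits.ValiantsHypothesis.ValiantsHypothesis.Theorems.LacunarySymmetroidMatrixDescartesDefiniteMomentsZonesSigns
import Summits.ValiantsHypothesis.ValiantsHypothesis.Theorems.LacunarySymmetroidMatrixDescartesDefiniteMomentsRayleighSharp
import Summits.ValiantsHypothesis.ValiantsHypothesis.Theorems.LacunarySymmetroidMatrixDescartesDefiniteMomentsRayleigh

/-!
# `MatrixDescartes` (stmt-ValiantsHypothesis-18050) — the DEFINITE-MOMENTS LAW, zones II: the Rayleigh K-nomials of a
# Rayleigh-sharp pencil (root count, scaling, enumeration, sign law)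

HONEST FRAMING.  Cell `pub-symmetroid`, seat `val-sym-mdr-p2` (gen 15); helper file `--supports` the crux
`Theses.LacunarySymmetroid.MatrixDescartes`, NO closure claim.  Bookkeeping for the lacunary Markus theorem; nothing here
bears on the crux in its window, on `stub_twoSided`, on `DoorA26`/`DoorA34`, registers, or `VP ≠ VNP`.

SETTING.  `K ≥ 2` real symmetric letters `S₀, …, S_{K−1}` (size `ι × ι`) at strictly increasing exponents `d`; the Rayleigh
`K`-nomial of `u` is `P_u = ∑ₗ (uᵀSₗu)·X^{dₗ}`, its positive root set `T_u`; RAYLEIGH-SHARP: `#T_u ≥ K − 1` for every `u ≠ 0`.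
* `rayleighPoly_smul` / `posRoots_smul`: `P_{c·u} = c²·P_u`, so `T_{c·u} = T_u` (`c ≠ 0`);
* `rayleighPoly_ne_zero_of_sharp`, `card_posRoots_eq_of_sharp` (`#T_u = K − 1` exactly, Descartes), `sharp_multiset`
  (no repeated positive root), `exists_enum_posRoots` (strictly increasing enumeration `Fin (K−1) → ℝ` of `T_u`);
* `trailingCoeff_rayleighPoly`, `rayleigh_near_zero` (sign `σ` of the lowest letter on some `(0, δ)`), and the PARITY LAW
  `rayleigh_sign_law`: `0 < σ·(−1)^{N(x,u)}·uᵀF(x)u` at every positive non-root `x`, `N(x,u) = #(T_u ∩ (0,x))`.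
[folklore]; axioms `propext`, `Classical.choice`, `Quot.sound`; no definitions.
-/

-- layout Summits/ValiantsHypothesis/ValiantsHypothesis forces the duplicated namespace component
set_option linter.dupNamespace false

namespace Summit.ValiantsHypothesis.ValiantsHypothesis.Theorems.LacunarySymmetroidMatrixDescartes

open Polynomial Matrix Finset
open scoped BigOperators

namespace DefiniteMoments

section Rayleigh

variable {ι : Type} [Fintype ι]

/-! ## §1 Scaling -/

/-- `P_{c·u} = c²·P_u`. [folklore] -/
theorem rayleighPoly_smul {K : ℕ} (d : Fin K → ℕ) (S : Fin K → Matrix ι ι ℝ) (c : ℝ) (u : ι → ℝ) :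
    (∑ l, C ((c • u) ⬝ᵥ (S l *ᵥ (c • u))) * (X : ℝ[X]) ^ d l)
      = C (c ^ 2) * ∑ l, C (u ⬝ᵥ (S l *ᵥ u)) * (X : ℝ[X]) ^ d l := by
  rw [Finset.mul_sum]
  refine Finset.sum_congr rfl fun l _ => ?_
  rw [Matrix.mulVec_smul, dotProduct_smul, smul_dotProduct, smul_eq_mul, smul_eq_mul, ← mul_assoc (C (c ^ 2)),
    ← C_mul]
  congr 2
  ring

/-- The evaluated Rayleigh form scales by `c²`. [folklore] -/
theorem form_smul {K : ℕ} (d : Fin K → ℕ) (S : Fin K → Matrix ι ι ℝ) (c : ℝ) (u : ι → ℝ) (x : ℝ) :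
    (c • u) ⬝ᵥ ((∑ k, x ^ d k • S k) *ᵥ (c • u)) = c ^ 2 * (u ⬝ᵥ ((∑ k, x ^ d k • S k) *ᵥ u)) := by
  rw [Matrix.mulVec_smul, dotProduct_smul, smul_dotProduct, smul_eq_mul, smul_eq_mul]
  ring

/-- `T_{c·u} = T_u` for `c ≠ 0`: scaling a vector does not move the positive roots of its Rayleigh `K`-nomial. [folklore] -/
theorem posRoots_smul {K : ℕ} (d : Fin K → ℕ) (S : Fin K → Matrix ι ι ℝ) {c : ℝ} (hc : c ≠ 0) (u : ι → ℝ) :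
    (∑ l, C ((c • u) ⬝ᵥ (S l *ᵥ (c • u))) * (X : ℝ[X]) ^ d l).roots.toFinset
      = (∑ l, C (u ⬝ᵥ (S l *ᵥ u)) * (X : ℝ[X]) ^ d l).roots.toFinset := by
  rw [rayleighPoly_smul, Polynomial.roots_C_mul _ (pow_ne_zero 2 hc)]

/-! ## §2 Root count of a Rayleigh-sharp pencil -/

/-- A Rayleigh-sharp pencil (`K ≥ 2`) has non-zero Rayleigh `K`-nomials at every `u ≠ 0`. [folklore] -/
theorem rayleighPoly_ne_zero_of_sharp {K : ℕ} (hK : 2 ≤ K) (d : Fin K → ℕ) (S : Fin K → Matrix ι ι ℝ)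
    (hsharp : ∀ v : ι → ℝ, v ≠ 0 →
      K ≤ ((∑ l, C (v ⬝ᵥ (S l *ᵥ v)) * (X : ℝ[X]) ^ d l).roots.toFinset.filter (fun t => 0 < t)).card + 1)
    (u : ι → ℝ) (hu : u ≠ 0) : (∑ l, C (u ⬝ᵥ (S l *ᵥ u)) * (X : ℝ[X]) ^ d l) ≠ 0 := by
  intro h0
  have h := hsharp u hu
  rw [h0, Polynomial.roots_zero, Multiset.toFinset_zero, Finset.filter_empty, Finset.card_empty] at h
  omega

/-- Descartes' bound for the Rayleigh `K`-nomial: at most `K − 1` distinct positive roots (any `u` with `P_u ≠ 0`).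
[folklore] -/
theorem card_posRoots_le {K : ℕ} (d : Fin K → ℕ) (S : Fin K → Matrix ι ι ℝ) (u : ι → ℝ)
    (hP : (∑ l, C (u ⬝ᵥ (S l *ᵥ u)) * (X : ℝ[X]) ^ d l) ≠ 0) :
    ((∑ l, C (u ⬝ᵥ (S l *ᵥ u)) * (X : ℝ[X]) ^ d l).roots.toFinset.filter (fun t => 0 < t)).card + 1 ≤ K := by
  have h1 := Literature.Computability.AlgebraicComplexity.card_roots_toFinset_filter_pos_lt_card_support hP
  have h2 : (∑ l, C (u ⬝ᵥ (S l *ᵥ u)) * (X : ℝ[X]) ^ d l).support.card ≤ K := by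
    refine (Literature.Computability.AlgebraicComplexity.card_support_sum_le _ _).trans ?_
    calc ∑ k, (C (u ⬝ᵥ (S k *ᵥ u)) * (X : ℝ[X]) ^ d k).support.card
        ≤ ∑ _k : Fin K, 1 := Finset.sum_le_sum fun k _ => Polynomial.card_support_C_mul_X_pow_le_one
      _ = K := by rw [Finset.sum_const, Finset.card_univ, Fintype.card_fin, smul_eq_mul, mul_one]
  omega

/-- **`#T_u = K − 1` exactly** on a Rayleigh-sharp pencil. [folklore] -/
theorem card_posRoots_eq_of_sharp {K : ℕ} (hK : 2 ≤ K) (d : Fin K → ℕ) (S : Fin K → Matrix ι ι ℝ)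
    (hsharp : ∀ v : ι → ℝ, v ≠ 0 →
      K ≤ ((∑ l, C (v ⬝ᵥ (S l *ᵥ v)) * (X : ℝ[X]) ^ d l).roots.toFinset.filter (fun t => 0 < t)).card + 1)
    (u : ι → ℝ) (hu : u ≠ 0) :
    ((∑ l, C (u ⬝ᵥ (S l *ᵥ u)) * (X : ℝ[X]) ^ d l).roots.toFinset.filter (fun t => 0 < t)).card = K - 1 := by
  have h1 := hsharp u hu
  have h2 := card_posRoots_le d S u (rayleighPoly_ne_zero_of_sharp hK d S hsharp u hu)
  omega

/-- **No repeated positive root**: on a Rayleigh-sharp pencil the positive roots of `P_u` counted with multiplicity are no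
more than the distinct ones (Descartes with multiplicity: `#roots ≤ Var ≤ K − 1`). [folklore] -/
theorem sharp_multiset {K : ℕ} (hK : 2 ≤ K) (d : Fin K → ℕ) (S : Fin K → Matrix ι ι ℝ)
    (hsharp : ∀ v : ι → ℝ, v ≠ 0 →
      K ≤ ((∑ l, C (v ⬝ᵥ (S l *ᵥ v)) * (X : ℝ[X]) ^ d l).roots.toFinset.filter (fun t => 0 < t)).card + 1)
    (u : ι → ℝ) (hu : u ≠ 0) :
    ((∑ l, C (u ⬝ᵥ (S l *ᵥ u)) * (X : ℝ[X]) ^ d l).roots.filter (fun t => 0 < t)).card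
      ≤ ((∑ l, C (u ⬝ᵥ (S l *ᵥ u)) * (X : ℝ[X]) ^ d l).roots.toFinset.filter (fun t => 0 < t)).card := by
  have h4 := card_posRoots_eq_of_sharp hK d S hsharp u hu
  set P := ∑ l, C (u ⬝ᵥ (S l *ᵥ u)) * (X : ℝ[X]) ^ d l with hP
  have hP0 : P ≠ 0 := rayleighPoly_ne_zero_of_sharp hK d S hsharp u hu
  have h1 : (P.roots.filter (fun t => 0 < t)).card ≤ P.signVariations := by
    rw [← Multiset.countP_eq_card_filter]; exact P.roots_countP_pos_le_signVariations
  have h2 := Literature.Computability.AlgebraicComplexity.signVariations_lt_card_support hP0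
  have h3 : P.support.card ≤ K := by
    refine (Literature.Computability.AlgebraicComplexity.card_support_sum_le _ _).trans ?_
    calc ∑ k, (C (u ⬝ᵥ (S k *ᵥ u)) * (X : ℝ[X]) ^ d k).support.card
        ≤ ∑ _k : Fin K, 1 := Finset.sum_le_sum fun k _ => Polynomial.card_support_C_mul_X_pow_le_one
      _ = K := by rw [Finset.sum_const, Finset.card_univ, Fintype.card_fin, smul_eq_mul, mul_one]
  omega

/-- **Enumeration of the positive roots.**  On a Rayleigh-sharp pencil, `T_u` (`u ≠ 0`) is enumerated by a strictly
increasing map `Fin (K − 1) → ℝ`. [folklore] -/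
theorem exists_enum_posRoots {K : ℕ} (hK : 2 ≤ K) (d : Fin K → ℕ) (S : Fin K → Matrix ι ι ℝ)
    (hsharp : ∀ v : ι → ℝ, v ≠ 0 →
      K ≤ ((∑ l, C (v ⬝ᵥ (S l *ᵥ v)) * (X : ℝ[X]) ^ d l).roots.toFinset.filter (fun t => 0 < t)).card + 1)
    (u : ι → ℝ) (hu : u ≠ 0) :
    ∃ r : Fin (K - 1) → ℝ, StrictMono r ∧
      ∀ x : ℝ, x ∈ ((∑ l, C (u ⬝ᵥ (S l *ᵥ u)) * (X : ℝ[X]) ^ d l).roots.toFinset.filter (fun t => 0 < t))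
        ↔ ∃ i, r i = x := by
  set T := ((∑ l, C (u ⬝ᵥ (S l *ᵥ u)) * (X : ℝ[X]) ^ d l).roots.toFinset.filter (fun t => 0 < t)) with hT
  have hcard : T.card = K - 1 := card_posRoots_eq_of_sharp hK d S hsharp u hu
  refine ⟨fun i => T.orderEmbOfFin hcard i, (T.orderEmbOfFin hcard).strictMono, fun x => ?_⟩
  constructor
  · intro hx
    have hx' : x ∈ Set.range (T.orderEmbOfFin hcard) := by rw [Finset.range_orderEmbOfFin]; exact hx
    obtain ⟨i, hi⟩ := hx'
    exact ⟨i, hi⟩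
  · rintro ⟨i, rfl⟩
    exact Finset.orderEmbOfFin_mem T hcard i

/-! ## §3 The sign near `0⁺` and the parity law -/

/-- The trailing coefficient of the Rayleigh `K`-nomial at strictly increasing exponents is the lowest Rayleigh coefficient
`uᵀS₀u` (when it is non-zero). [folklore] -/
theorem trailingCoeff_rayleighPoly {K : ℕ} (hK : 2 ≤ K) (d : Fin K → ℕ) (hd : StrictMono d)
    (S : Fin K → Matrix ι ι ℝ) (u : ι → ℝ) (h0 : u ⬝ᵥ (S ⟨0, by omega⟩ *ᵥ u) ≠ 0) :
    (∑ l, C (u ⬝ᵥ (S l *ᵥ u)) * (X : ℝ[X]) ^ d l).trailingCoeff = u ⬝ᵥ (S ⟨0, by omega⟩ *ᵥ u) := by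
  set P := ∑ l, C (u ⬝ᵥ (S l *ᵥ u)) * (X : ℝ[X]) ^ d l with hP
  set l₀ : Fin K := ⟨0, by omega⟩ with hl₀
  have hmin : ∀ l : Fin K, d l₀ ≤ d l := fun l => hd.monotone (Fin.mk_le_mk.2 (Nat.zero_le _))
  have hcoeff0 : P.coeff (d l₀) = u ⬝ᵥ (S l₀ *ᵥ u) := by
    rw [hP, coeff_rayleighPoly, Finset.sum_eq_single l₀]
    · rw [if_pos rfl]
    · intro l _ hl
      rw [if_neg]
      intro h
      exact hl (hd.injective h.symm)
    · intro h; exact absurd (Finset.mem_univ _) h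
  have hlow : ∀ n < d l₀, P.coeff n = 0 := by
    intro n hn
    rw [hP, coeff_rayleighPoly]
    refine Finset.sum_eq_zero fun l _ => ?_
    rw [if_neg]
    intro h
    have := hmin l
    omega
  have hP0 : P ≠ 0 := by
    intro h
    rw [h, coeff_zero] at hcoeff0
    exact h0 hcoeff0.symm
  have hntd : P.natTrailingDegree = d l₀ :=
    le_antisymm (natTrailingDegree_le_of_ne_zero (by rw [hcoeff0]; exact h0)) (le_natTrailingDegree hP0 hlow)
  rw [Polynomial.trailingCoeff, hntd, hcoeff0]

/-- **Sign near `0⁺`.**  On a Rayleigh-sharp pencil with global letter sign `σ` (`σ·(−1)^l·uᵀSₗu > 0`), every Rayleigh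
form `uᵀF(x)u` (`u ≠ 0`) has the sign `σ` on some interval `(0, δ)`. [folklore] -/
theorem rayleigh_near_zero {K : ℕ} (hK : 2 ≤ K) (d : Fin K → ℕ) (hd : StrictMono d)
    (S : Fin K → Matrix ι ι ℝ) (σ : ℝ)
    (hσ : ∀ (l : Fin K) (v : ι → ℝ), v ≠ 0 → 0 < σ * (-1) ^ (l : ℕ) * (v ⬝ᵥ (S l *ᵥ v)))
    (u : ι → ℝ) (hu : u ≠ 0) :
    ∃ δ : ℝ, 0 < δ ∧ ∀ x : ℝ, 0 < x → x < δ →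
      0 < σ * (∑ l, C (u ⬝ᵥ (S l *ᵥ u)) * (X : ℝ[X]) ^ d l).eval x := by
  have h0 := hσ ⟨0, by omega⟩ u hu
  simp only [pow_zero, mul_one] at h0
  have hne : u ⬝ᵥ (S ⟨0, by omega⟩ *ᵥ u) ≠ 0 := by
    intro h; rw [h, mul_zero] at h0; exact lt_irrefl 0 h0
  have htc : 0 < σ * (∑ l, C (u ⬝ᵥ (S l *ᵥ u)) * (X : ℝ[X]) ^ d l).trailingCoeff := by
    rw [trailingCoeff_rayleighPoly hK d hd S u hne]; exact h0
  exact eventually_pos_near_zero _ σ htc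

/-- **THE PARITY LAW of a Rayleigh-sharp pencil.**  With global letter sign `σ`, at every `u ≠ 0` and every positive
`x` that is not a root of `P_u`:  `0 < σ·(−1)^{N(x,u)}·uᵀF(x)u`, where `N(x, u)` counts the roots of `P_u` in `(0, x)`.
[folklore] -/
theorem rayleigh_sign_law {K : ℕ} (hK : 2 ≤ K) (d : Fin K → ℕ) (hd : StrictMono d)
    (S : Fin K → Matrix ι ι ℝ)
    (hsharp : ∀ v : ι → ℝ, v ≠ 0 →
      K ≤ ((∑ l, C (v ⬝ᵥ (S l *ᵥ v)) * (X : ℝ[X]) ^ d l).roots.toFinset.filter (fun t => 0 < t)).card + 1)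
    (σ : ℝ) (hσ : ∀ (l : Fin K) (v : ι → ℝ), v ≠ 0 → 0 < σ * (-1) ^ (l : ℕ) * (v ⬝ᵥ (S l *ᵥ v)))
    (u : ι → ℝ) (hu : u ≠ 0) {x : ℝ} (hx : 0 < x)
    (hxr : ¬ (∑ l, C (u ⬝ᵥ (S l *ᵥ u)) * (X : ℝ[X]) ^ d l).IsRoot x) :
    0 < σ * (-1) ^ ((∑ l, C (u ⬝ᵥ (S l *ᵥ u)) * (X : ℝ[X]) ^ d l).roots.toFinset.filter
        (fun t => 0 < t ∧ t < x)).card * (u ⬝ᵥ ((∑ k, x ^ d k • S k) *ᵥ u)) := by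
  rw [← eval_rayleighPoly]
  exact sharp_sign_law _ (rayleighPoly_ne_zero_of_sharp hK d S hsharp u hu) (sharp_multiset hK d S hsharp u hu) σ
    (rayleigh_near_zero hK d hd S σ hσ u hu) x hx hxr

/-- Root test in Rayleigh-form currency: on a Rayleigh-sharp pencil, `x` is a root of `P_u` (`u ≠ 0`) iff `uᵀF(x)u = 0`.
[folklore] -/
theorem isRoot_iff_form_eq_zero {K : ℕ} (d : Fin K → ℕ) (S : Fin K → Matrix ι ι ℝ) (u : ι → ℝ) (x : ℝ) :
    (∑ l, C (u ⬝ᵥ (S l *ᵥ u)) * (X : ℝ[X]) ^ d l).IsRoot x ↔ u ⬝ᵥ ((∑ k, x ^ d k • S k) *ᵥ u) = 0 := by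
  rw [Polynomial.IsRoot, eval_rayleighPoly]

/-- Membership in `T_u` in Rayleigh-form currency (`P_u ≠ 0`). [folklore] -/
theorem mem_posRoots_iff {K : ℕ} (d : Fin K → ℕ) (S : Fin K → Matrix ι ι ℝ) (u : ι → ℝ)
    (hP : (∑ l, C (u ⬝ᵥ (S l *ᵥ u)) * (X : ℝ[X]) ^ d l) ≠ 0) (x : ℝ) :
    x ∈ ((∑ l, C (u ⬝ᵥ (S l *ᵥ u)) * (X : ℝ[X]) ^ d l).roots.toFinset.filter (fun t => 0 < t))
      ↔ 0 < x ∧ u ⬝ᵥ ((∑ k, x ^ d k • S k) *ᵥ u) = 0 := by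
  rw [Finset.mem_filter, Multiset.mem_toFinset, mem_roots hP, isRoot_iff_form_eq_zero, and_comm]

end Rayleigh

end DefiniteMoments

end Summit.ValiantsHypothesis.ValiantsHypothesis.Theorems.LacunarySymmetroidMatrixDescartes
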